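import Literature.MathematicalPhysics.QuantumFieldTheory.Balaban1983to89.B4PairLetterL2
import Literature.MathematicalPhysics.QuantumFieldTheory.Balaban1983to89.B4Thm110RegionLpDeriv
import Literature.MathematicalPhysics.QuantumFieldTheory.Balaban1983to89.B4Ineq112LpChain

/-!
# `Balaban1983to89.B4Thm112RegionLp` — [Balaban1983RegularityDecay] THEOREM p. 573, (1.11)–(1.12): THE δG CLAUSE
# `|(δG_k(Ω,Ω₀,A)f)(x)| = |(G_k(Ω,A)f)(x) − (G_k(Ω₀,A)f)(x)|`, VALUE MEMBER, FOR A GENERAL PAIR `Ω ⊂ Ω₀` OF FINITE UNIONS OF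
# `K`-BLOCKS UNDER THE PRINTED `R₀` RESTRICTION — r01 g6's mixed `L^p` chain `B4Ineq112LpChain.ineq112_value_lp` with
# every structural hypothesis DISCHARGED on the two cube-propagator families of `B4CubeGreenRegionPair`

statement-level skeleton of published theorems with citation tags; proofs where landed; nothing here is a claim about the Yang–Mills mass gap

WHAT THIS FILE DOES.  The print (p. 573): «If Ω ⊂ Ω₀, then for δG_k(Ω,Ω₀,A) = G_k(Ω,A) − G_k(Ω₀,A) (1.11) we have the
inequalities (1.9), (1.10) (with the same restrictions on x, x′) with the additional factor (1.12)»; (p. 579) «the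
terms of the expansions with interior cubes … cancel».  §1 **`thm112_value_region_of_inputs`**: the chain
`ineq112_value_lp_apply` on `X = fineDom n Ω₀c` with `Ω = {blk x ∈ Ωc}`, `G = B4RegionPairGreen.pairGreen`
(`= pad G_k(Ω,A) + pad G_k(Ω₀∖Ω,A)`, read on `Ω` it is `G_k(Ω,A)`), `G′ = G_k(Ω₀,A)`, the families
`atGreen₂`/`atGreenΩ` (`hGj`, `hGjΩ` for every cube), `good j ⟺ □̂_j ⊆ Ω`; the per-cube inputs for BOTH families at
the cubes interior to `Ω` from `B4Thm110RegionLpDeriv.chain_letter_inputs` on `Ω₀` (the letters coincide there: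
`letterΩ_a_eq`/`letterΩ_b_eq`), the `‖·‖_{2,η}` letters at every other cube from Lemma 2.1 on `Ω₀ ∩ □̂_j` (first family)
and on `Ω ∩ □̂_j`, `(Ω₀∖Ω) ∩ □̂_j` (second family, `B4PairLetterL2.lpv_two_letterΩ_bad_le`).  CONCLUSION for
`x ∈ Ω` with `R₀` in label form, `f` supported in `P × ι` with `‖f‖_{2,η} ≤ V‖f‖_∞`, `D ≤ dist_∞(x, P)`,
`D₀ ≤ dist_∞(x, Ω^c)`, `D₁ ≤ dist_∞(P, Ω^c)` (fine units):
`|(G_k(Ω,A)(f|_Ω))(x)_i − (G_k(Ω₀,A)f)(x)_i| ≤ 2^{d+3}e^{17/4}·max(√N c_G, 2)·V·exp(−(D+D₀+D₁)/(2nK))·‖f‖_∞`.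
§2 **`thm112_value_region`** — hypothesis-free, the inputs DISCHARGED as in `B4Thm110RegionLp.thm110_value_region`
(Lemma 2.2 at `Ã_j` on the translated boxes; Lemma 2.1 on the three kinds of sub-regions; «e sufficiently small»).

HONEST SCOPE.  As `B4Thm110RegionLp` (abelian one-parameter flow = (1.2), component field, staircase contours, `ℓ^∞`
over sites and colours, the `L²`-comparison `V`, `K` = the print's `M` chosen existentially after `d, N`, the flow, `L`
and the windows; `R₀ = K(d+3)` unit labels around `x` INSIDE `Ω`); the cube configurations are `Ã_j` at the cubes
interior to `Ω` and `A` at every other cube (the print takes `Ã_j` at every cube interior to `Ω₀` — a bookkeeping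
choice the expansion (2.13) permits, DISCLOSED in `B4CubeGreenRegionPair`); `f` lives on the sites of `Ω₀` and
`G_k(Ω,A)` acts on its restriction to `Ω` (for `f` supported in `Ω` this is the print's `δG_k(Ω,Ω₀,A)f`); only the
VALUE member of the δG clause (the derivative and Hölder members of (1.11)–(1.12) are r01 g6's
`B4Ineq112LpChainMembers`, not instantiated here).  No `Prop` fact, no `sorry`; axioms standard.
-/

namespace Literature.MathematicalPhysics.QuantumFieldTheory.Balaban1983to89.B4Thm112RegionLp


open Literature.MathematicalPhysics.QuantumFieldTheory.Balaban1983to89.B4Reflection242 (boxDom mem_boxDom nbrs mem_nbrs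
  blk blk_mem_boxDom)
open Literature.MathematicalPhysics.QuantumFieldTheory.Balaban1983to89.B4GaugeCovariance
open Literature.MathematicalPhysics.QuantumFieldTheory.Balaban1983to89.B4Commutators25to211 (mulH opK)
open Literature.MathematicalPhysics.QuantumFieldTheory.Balaban1983to89.B4Lower18 (fineDom mem_fineDom IsBlockUnion)
open Literature.MathematicalPhysics.QuantumFieldTheory.Balaban1983to89.B4Lower18Regular (e1 baseEmb stairContour
  base_le_of_blk)
open Literature.MathematicalPhysics.QuantumFieldTheory.Balaban1983to89.B4Lower18RegularRegion (regWt rBlkWt rbaseEmb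
  rstairContour regWt_nonneg rBlkWt_ne_zero compField)
open Literature.MathematicalPhysics.QuantumFieldTheory.Balaban1983to89.B4Lemma21Region (regionOp)
open Literature.MathematicalPhysics.QuantumFieldTheory.Balaban1983to89.B4Lemma22ReduceZero (Box opA greenA)
open Literature.MathematicalPhysics.QuantumFieldTheory.Balaban1983to89.B4Lemma22Reduce231 (supN supN_nonneg)
open Literature.MathematicalPhysics.QuantumFieldTheory.Balaban1983to89.B4Lemma22EtaBox (vol vol_pos lpW lpW_nonneg)
open Literature.MathematicalPhysics.QuantumFieldTheory.Balaban1983to89.B4Lemma22LpStair (lpM lpM_nonneg)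
open Literature.MathematicalPhysics.QuantumFieldTheory.Balaban1983to89.B4PartitionUnity22 (hCube hCube_ne_zero_imp hprof
  D1 D2 D1_nonneg D2_nonneg contDiff_hprof hasCompactSupport_hprof)
open Literature.MathematicalPhysics.QuantumFieldTheory.Balaban1983to89.B4Eq220PartitionSizes (hZ hBox)
open Literature.MathematicalPhysics.QuantumFieldTheory.Balaban1983to89.B4Eq220CommutatorField (kOp)
open Literature.MathematicalPhysics.QuantumFieldTheory.Balaban1983to89.B4CubeFields22 (cubeField cubeField_eq_compField)
open Literature.MathematicalPhysics.QuantumFieldTheory.Balaban1983to89.B4CubeFieldHyps22 (aSeq_window cubeField_threshold)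
open Literature.MathematicalPhysics.QuantumFieldTheory.Balaban1983to89.B4Eq220CubeField (lemma22_sup_cubeField
  eq220_cubeField_std eq221_cubeField)
open Literature.MathematicalPhysics.QuantumFieldTheory.Balaban1983to89.B4Eq221PsupCubeField (eq221_psup_cubeField_std)
open Literature.MathematicalPhysics.QuantumFieldTheory.Balaban1983to89.B4Eq221L2FactorRegion (acBond kOpR)
open Literature.MathematicalPhysics.QuantumFieldTheory.Balaban1983to89.B4Eq221HjRegion (eq221_l2_region_hZ)
open Literature.MathematicalPhysics.QuantumFieldTheory.Balaban1983to89.B4CubeOpReindex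
open Literature.MathematicalPhysics.QuantumFieldTheory.Balaban1983to89.B4WalkRouteRegion (rpos labels labels_complete
  regWt_local rBlkWt_local green_mul_op)
open Literature.MathematicalPhysics.QuantumFieldTheory.Balaban1983to89.B4RegionCubeCarrier
open Literature.MathematicalPhysics.QuantumFieldTheory.Balaban1983to89.B4CubeGreenRegion
open Literature.MathematicalPhysics.QuantumFieldTheory.Balaban1983to89.B4LpNormTransfer
open Literature.MathematicalPhysics.QuantumFieldTheory.Balaban1983to89.B4Thm110RegionLp
open Literature.MathematicalPhysics.QuantumFieldTheory.Balaban1983to89.B4Ineq110LpChain (lpv lpv_nonneg lvl lvl_zero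
  lvl_succ lpv_two_le)
open Literature.MathematicalPhysics.QuantumFieldTheory.Balaban1983to89.B4Ineq112LpChain (ineq112_value_lp_apply)
open Literature.MathematicalPhysics.QuantumFieldTheory.Balaban1983to89.B4Thm110RegionLpDeriv (chainLetter chain_letter_inputs)
open Literature.MathematicalPhysics.QuantumFieldTheory.Balaban1983to89.B4RegionPairGreen
open Literature.MathematicalPhysics.QuantumFieldTheory.Balaban1983to89.B4CubeGreenRegionPair
open Literature.MathematicalPhysics.QuantumFieldTheory.Balaban1983to89.B4PairLetterL2 (lpv_two_letterΩ_bad_le)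
open scoped Matrix
open scoped Matrix.Norms.Operator

noncomputable section

variable {d : ℕ}

/-! ## §1. (1.11)–(1.12), value member, on a general pair from the per-cube inputs -/

section Inputs

variable {ι : Type} [Fintype ι] [DecidableEq ι]

omit [Fintype ι] [DecidableEq ι] in
/-- a site of the cube `□_j` (label in `[K(j−1), K(j+1))^{d+1}`) is within `M = nK` of the centre `nKj` (the chain's
`hS1`). [cite: Balaban1983RegularityDecay, §2 p.575 «□_j … a cube of the size 2M and with center in Mj»] -/
private theorem abs_rpos_sub_le_of_cubeS {ℓ k : ℕ} (hn : 1 ≤ (ℓ + 1) ^ k) (Ω₀c : Finset (Fin (d + 1) → ℤ)) (K : ℕ)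
    (j : Fin (d + 1) → ℤ) (z : ↥(fineDom ((ℓ + 1) ^ k) Ω₀c)) (hz : cubeS ℓ k Ω₀c K j z) (μ : Fin (d + 1)) :
    |rpos ((ℓ + 1) ^ k) Ω₀c z μ - ((((ℓ + 1) ^ k : ℕ) : ℝ) * K) * j μ| ≤ (((ℓ + 1) ^ k : ℕ) : ℝ) * K := by
  have hn0 : (0 : ℤ) < ((((ℓ + 1) ^ k : ℕ)) : ℤ) := by exact_mod_cast hn
  obtain ⟨h1, h2⟩ := hz μ
  simp only [cshift] at h1 h2
  have hdiv := Int.mul_ediv_add_emod (z.1 μ) ((((ℓ + 1) ^ k : ℕ)) : ℤ)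
  have hr0 := Int.emod_nonneg (z.1 μ) hn0.ne'
  have hr1 := Int.emod_lt_of_pos (z.1 μ) hn0
  have hb : blk ((ℓ + 1) ^ k) z.1 μ = z.1 μ / ((((ℓ + 1) ^ k : ℕ)) : ℤ) := rfl
  rw [hb] at h1 h2
  have hlo : ((((ℓ + 1) ^ k : ℕ)) : ℤ) * ((K : ℤ) * (j μ - 1)) ≤ z.1 μ := by
    have := mul_le_mul_of_nonneg_left h1 hn0.le
    linarith
  have hhi : z.1 μ < ((((ℓ + 1) ^ k : ℕ)) : ℤ) * ((K : ℤ) * (j μ - 1) + 2 * K) := by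
    have h2' : z.1 μ / ((((ℓ + 1) ^ k : ℕ)) : ℤ) < (K : ℤ) * (j μ - 1) + 2 * K := by
      have := h2; simp only [Nat.cast_mul, Nat.cast_ofNat] at this; exact this
    have h3 : z.1 μ / ((((ℓ + 1) ^ k : ℕ)) : ℤ) + 1 ≤ (K : ℤ) * (j μ - 1) + 2 * K := Int.add_one_le_iff.mpr h2'
    have := mul_le_mul_of_nonneg_left h3 hn0.le
    linarith
  have hlo' : ((((ℓ + 1) ^ k : ℕ) : ℝ)) * ((K : ℝ) * ((j μ : ℝ) - 1)) ≤ ((z.1 μ : ℤ) : ℝ) := by exact_mod_cast hlo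
  have hhi' : ((z.1 μ : ℤ) : ℝ) < ((((ℓ + 1) ^ k : ℕ) : ℝ)) * ((K : ℝ) * ((j μ : ℝ) - 1) + 2 * K) := by
    exact_mod_cast hhi
  show |((z.1 μ : ℤ) : ℝ) - _| ≤ _
  rw [abs_le]
  constructor <;> nlinarith

/-- **THEOREM (1.11)–(1.12), VALUE MEMBER, ON A GENERAL PAIR `Ω ⊂ Ω₀` UNDER `R₀`, FROM THE PER-CUBE INPUTS** (every
structural hypothesis of r01 g6's `B4Ineq112LpChain.ineq112_value_lp` DISCHARGED on [B4]'s concrete data).  INPUTS: at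
the cubes interior to `Ω₀`, on the translated `2K`-boxes at `Ã_j`, `‖G_k(□,Ã)Φ‖_∞ ≤ c_G‖Φ‖_∞` (2.17) and the
(2.20)/(2.21) letters `≤ c_K·…`; at every cube Lemma 2.1's `‖·‖_{2,η}` letter on `Ω₀ ∩ □̂_j`, on `Ω ∩ □̂_j` and on
`(Ω₀∖Ω) ∩ □̂_j` (configuration `A`); `3^{d+1}√N c_K ≤ e^{−1}`; `R₀`: every unit label within `K(n₀+2)` of the block of
`x` lies in `Ω`.  CONCLUSION for `f` on the sites of `Ω₀` supported in `P × ι` with `‖f‖_{2,η} ≤ V‖f‖_∞`, `D`, `D₀`,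
`D₁` lower bounds of the `ℓ^∞` separations (fine units) `x`–`P`, `x`–`Ω^c`, `P`–`Ω^c`:
`|(G_k(Ω,A)(f|_Ω))(x)_i − (G_k(Ω₀,A)f)(x)_i| ≤ 2^{d+3}e^{17/4}·max(√N c_G,2)·V·e^{−(D+D₀+D₁)/(2nK)}·‖f‖_∞`.
[cite: Balaban1983RegularityDecay, Theorem (1.11)–(1.12) p.573; (2.13) p.577; (2.20)–(2.22) pp.578–579; p.579 «terms … with interior cubes … cancel»] -/
theorem thm112_value_region_of_inputs (F : OrthFlow ι) (κ : ℝ) {ℓ k : ℕ} (hℓ : 1 ≤ ℓ) (hk : 1 ≤ k)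
    (hn : 1 ≤ (ℓ + 1) ^ k) (Ω₀c Ωc : Finset (Fin (d + 1) → ℤ)) (hsub : Ωc ⊆ Ω₀c) {K : ℕ} (hK8 : 8 ≤ K) (hK4 : 4 ∣ K)
    {a m2 : ℝ} (ha : 0 < a) (hm : 0 ≤ m2) (Ac : (Fin (d + 1) → ℤ) → Fin (d + 1) → ℝ) {cG cK : ℝ} (hcG : 0 ≤ cG)
    (hcK : 0 ≤ cK) {n₀ : ℕ} (hn₀ : 0 < n₀)
    (hG : ∀ j, cubeLabels K j ⊆ Ω₀c → ∀ Φ : ↥(Box d ℓ k fun _ : Fin (d + 1) => 2 * K) × ι → ℝ,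
      supN (greenA d F κ ℓ k a m2 (fun _ => 2 * K) (baseEmb hn _) (stairContour hn _) (boxFld ℓ k K Ac j) *ᵥ Φ)
        ≤ cG * supN Φ)
    (h0 : ∀ j, cubeLabels K j ⊆ Ω₀c → ∀ Φ : ↥(Box d ℓ k fun _ : Fin (d + 1) => 2 * K) × ι → ℝ,
      supN (kOp F κ ((ℓ + 1) ^ k) (B1.aSeq a ((ℓ : ℝ) + 1) k) m2 (fun _ => 2 * K) (baseEmb hn _) (stairContour hn _)
            (boxFld ℓ k K Ac j) (hBox ((ℓ + 1) ^ k) K (fun _ => 2 * K) (fun _ => 1))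
          *ᵥ (greenA d F κ ℓ k a m2 (fun _ => 2 * K) (baseEmb hn _) (stairContour hn _) (boxFld ℓ k K Ac j)
            *ᵥ (mulH (ι := ι) (hBox ((ℓ + 1) ^ k) K (fun _ => 2 * K) (fun _ => 1)) *ᵥ Φ))) ≤ cK * supN Φ)
    (h1 : ∀ j, cubeLabels K j ⊆ Ω₀c → ∀ p : ℝ, 2 * (n₀ : ℝ) ≤ p →
      ∀ Φ : ↥(Box d ℓ k fun _ : Fin (d + 1) => 2 * K) × ι → ℝ,
      supN (kOp F κ ((ℓ + 1) ^ k) (B1.aSeq a ((ℓ : ℝ) + 1) k) m2 (fun _ => 2 * K) (baseEmb hn _) (stairContour hn _)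
            (boxFld ℓ k K Ac j) (hBox ((ℓ + 1) ^ k) K (fun _ => 2 * K) (fun _ => 1))
          *ᵥ (greenA d F κ ℓ k a m2 (fun _ => 2 * K) (baseEmb hn _) (stairContour hn _) (boxFld ℓ k K Ac j)
            *ᵥ (mulH (ι := ι) (hBox ((ℓ + 1) ^ k) K (fun _ => 2 * K) (fun _ => 1)) *ᵥ Φ))) ≤ cK * lpW d ℓ k p Φ)
    (hg : ∀ j, cubeLabels K j ⊆ Ω₀c → ∀ p q : ℝ, 1 ≤ p → p ≤ q → p⁻¹ - q⁻¹ ≤ (2 * (n₀ : ℝ))⁻¹ →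
      ∀ Φ : ↥(Box d ℓ k fun _ : Fin (d + 1) => 2 * K) × ι → ℝ,
      lpW d ℓ k q (kOp F κ ((ℓ + 1) ^ k) (B1.aSeq a ((ℓ : ℝ) + 1) k) m2 (fun _ => 2 * K) (baseEmb hn _)
            (stairContour hn _) (boxFld ℓ k K Ac j) (hBox ((ℓ + 1) ^ k) K (fun _ => 2 * K) (fun _ => 1))
          *ᵥ (greenA d F κ ℓ k a m2 (fun _ => 2 * K) (baseEmb hn _) (stairContour hn _) (boxFld ℓ k K Ac j)
            *ᵥ (mulH (ι := ι) (hBox ((ℓ + 1) ^ k) K (fun _ => 2 * K) (fun _ => 1)) *ᵥ Φ))) ≤ cK * lpW d ℓ k p Φ)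
    (hb : ∀ (j : Fin (d + 1) → ℤ) (Φ : ↥(fineDom ((ℓ + 1) ^ k) (subLabels Ω₀c K j)) × ι → ℝ),
      lpW d ℓ k 2 (opK (regWt ((ℓ + 1) ^ k) (fineDom ((ℓ + 1) ^ k) (subLabels Ω₀c K j))) m2
            (B1.aSeq a ((ℓ : ℝ) + 1) k * (((((ℓ + 1) ^ k : ℕ)) : ℝ) ^ (d + 1))⁻¹)
            (rBlkWt ((ℓ + 1) ^ k) (subLabels Ω₀c K j) (fineDom ((ℓ + 1) ^ k) (subLabels Ω₀c K j)))
            (fieldLink F κ (acBond (subLabels Ω₀c K j) Ac))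
            (contourTrans (fieldLink F κ (acBond (subLabels Ω₀c K j) Ac)) (rbaseEmb hn (subLabels Ω₀c K j))
              (rstairContour hn (subLabels Ω₀c K j)))
            (fun a : ↥(fineDom ((ℓ + 1) ^ k) (subLabels Ω₀c K j)) => hZ ((ℓ + 1) ^ k) K j a.1)
          *ᵥ ((covOp (regWt ((ℓ + 1) ^ k) (fineDom ((ℓ + 1) ^ k) (subLabels Ω₀c K j))) m2
                (B1.aSeq a ((ℓ : ℝ) + 1) k * (((((ℓ + 1) ^ k : ℕ)) : ℝ) ^ (d + 1))⁻¹)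
                (rBlkWt ((ℓ + 1) ^ k) (subLabels Ω₀c K j) (fineDom ((ℓ + 1) ^ k) (subLabels Ω₀c K j)))
                (fieldLink F κ (acBond (subLabels Ω₀c K j) Ac))
                (contourTrans (fieldLink F κ (acBond (subLabels Ω₀c K j) Ac)) (rbaseEmb hn (subLabels Ω₀c K j))
                  (rstairContour hn (subLabels Ω₀c K j))))⁻¹
            *ᵥ (mulH (ι := ι) (fun a : ↥(fineDom ((ℓ + 1) ^ k) (subLabels Ω₀c K j)) => hZ ((ℓ + 1) ^ k) K j a.1)
              *ᵥ Φ))) ≤ cK * lpW d ℓ k 2 Φ)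
    (hbΩ₁ : ∀ (j : Fin (d + 1) → ℤ) (Φ : ↥(fineDom ((ℓ + 1) ^ k) (Ωc ∩ cubeLabels K j)) × ι → ℝ),
      lpW d ℓ k 2 (opK (regWt ((ℓ + 1) ^ k) (fineDom ((ℓ + 1) ^ k) (Ωc ∩ cubeLabels K j))) m2
            (B1.aSeq a ((ℓ : ℝ) + 1) k * (((((ℓ + 1) ^ k : ℕ)) : ℝ) ^ (d + 1))⁻¹)
            (rBlkWt ((ℓ + 1) ^ k) (Ωc ∩ cubeLabels K j) (fineDom ((ℓ + 1) ^ k) (Ωc ∩ cubeLabels K j)))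
            (fieldLink F κ (acBond (Ωc ∩ cubeLabels K j) Ac))
            (contourTrans (fieldLink F κ (acBond (Ωc ∩ cubeLabels K j) Ac)) (rbaseEmb hn (Ωc ∩ cubeLabels K j))
              (rstairContour hn (Ωc ∩ cubeLabels K j)))
            (fun a : ↥(fineDom ((ℓ + 1) ^ k) (Ωc ∩ cubeLabels K j)) => hZ ((ℓ + 1) ^ k) K j a.1)
          *ᵥ ((covOp (regWt ((ℓ + 1) ^ k) (fineDom ((ℓ + 1) ^ k) (Ωc ∩ cubeLabels K j))) m2
                (B1.aSeq a ((ℓ : ℝ) + 1) k * (((((ℓ + 1) ^ k : ℕ)) : ℝ) ^ (d + 1))⁻¹)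
                (rBlkWt ((ℓ + 1) ^ k) (Ωc ∩ cubeLabels K j) (fineDom ((ℓ + 1) ^ k) (Ωc ∩ cubeLabels K j)))
                (fieldLink F κ (acBond (Ωc ∩ cubeLabels K j) Ac))
                (contourTrans (fieldLink F κ (acBond (Ωc ∩ cubeLabels K j) Ac)) (rbaseEmb hn (Ωc ∩ cubeLabels K j))
                  (rstairContour hn (Ωc ∩ cubeLabels K j))))⁻¹
            *ᵥ (mulH (ι := ι) (fun a : ↥(fineDom ((ℓ + 1) ^ k) (Ωc ∩ cubeLabels K j)) => hZ ((ℓ + 1) ^ k) K j a.1) *ᵥ Φ))) ≤ cK * lpW d ℓ k 2 Φ)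
    (hbΩ₂ : ∀ (j : Fin (d + 1) → ℤ) (Φ : ↥(fineDom ((ℓ + 1) ^ k) (subLabels Ω₀c K j \ (Ωc ∩ cubeLabels K j))) × ι → ℝ),
      lpW d ℓ k 2 (opK (regWt ((ℓ + 1) ^ k) (fineDom ((ℓ + 1) ^ k) (subLabels Ω₀c K j \ (Ωc ∩ cubeLabels K j)))) m2
            (B1.aSeq a ((ℓ : ℝ) + 1) k * (((((ℓ + 1) ^ k : ℕ)) : ℝ) ^ (d + 1))⁻¹)
            (rBlkWt ((ℓ + 1) ^ k) (subLabels Ω₀c K j \ (Ωc ∩ cubeLabels K j)) (fineDom ((ℓ + 1) ^ k) (subLabels Ω₀c K j \ (Ωc ∩ cubeLabels K j))))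
            (fieldLink F κ (acBond (subLabels Ω₀c K j \ (Ωc ∩ cubeLabels K j)) Ac))
            (contourTrans (fieldLink F κ (acBond (subLabels Ω₀c K j \ (Ωc ∩ cubeLabels K j)) Ac)) (rbaseEmb hn (subLabels Ω₀c K j \ (Ωc ∩ cubeLabels K j)))
              (rstairContour hn (subLabels Ω₀c K j \ (Ωc ∩ cubeLabels K j))))
            (fun a : ↥(fineDom ((ℓ + 1) ^ k) (subLabels Ω₀c K j \ (Ωc ∩ cubeLabels K j))) => hZ ((ℓ + 1) ^ k) K j a.1)
          *ᵥ ((covOp (regWt ((ℓ + 1) ^ k) (fineDom ((ℓ + 1) ^ k) (subLabels Ω₀c K j \ (Ωc ∩ cubeLabels K j)))) m2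
                (B1.aSeq a ((ℓ : ℝ) + 1) k * (((((ℓ + 1) ^ k : ℕ)) : ℝ) ^ (d + 1))⁻¹)
                (rBlkWt ((ℓ + 1) ^ k) (subLabels Ω₀c K j \ (Ωc ∩ cubeLabels K j)) (fineDom ((ℓ + 1) ^ k) (subLabels Ω₀c K j \ (Ωc ∩ cubeLabels K j))))
                (fieldLink F κ (acBond (subLabels Ω₀c K j \ (Ωc ∩ cubeLabels K j)) Ac))
                (contourTrans (fieldLink F κ (acBond (subLabels Ω₀c K j \ (Ωc ∩ cubeLabels K j)) Ac)) (rbaseEmb hn (subLabels Ω₀c K j \ (Ωc ∩ cubeLabels K j)))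
                  (rstairContour hn (subLabels Ω₀c K j \ (Ωc ∩ cubeLabels K j)))))⁻¹
            *ᵥ (mulH (ι := ι) (fun a : ↥(fineDom ((ℓ + 1) ^ k) (subLabels Ω₀c K j \ (Ωc ∩ cubeLabels K j))) => hZ ((ℓ + 1) ^ k) K j a.1) *ᵥ Φ))) ≤ cK * lpW d ℓ k 2 Φ)
    (h3 : (3 : ℝ) ^ (d + 1) * (Real.sqrt (Fintype.card ι) * cK) ≤ Real.exp (-1))
    -- the site in `Ω`, `R₀`, the source and the three separations
    (x : ↥(fineDom ((ℓ + 1) ^ k) Ωc))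
    (hR₀ : ∀ y : Fin (d + 1) → ℤ, (∀ ν, |y ν - blk ((ℓ + 1) ^ k) x.1 ν| ≤ (K : ℤ) * (n₀ + 2)) → y ∈ Ωc)
    (P : ↥(fineDom ((ℓ + 1) ^ k) Ω₀c) → Prop) [DecidablePred P] {D D₀ D₁ : ℝ}
    (hD : ∀ x', P x' → ∃ ν, D ≤ |rpos ((ℓ + 1) ^ k) Ω₀c (incl hn hsub x) ν - rpos ((ℓ + 1) ^ k) Ω₀c x' ν|)
    (hD₀ : ∀ x₁ : ↥(fineDom ((ℓ + 1) ^ k) Ω₀c), ¬ inReg ((ℓ + 1) ^ k) Ωc x₁ →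
      ∃ ν, D₀ ≤ |rpos ((ℓ + 1) ^ k) Ω₀c (incl hn hsub x) ν - rpos ((ℓ + 1) ^ k) Ω₀c x₁ ν|)
    (hD₁ : ∀ x', P x' → ∀ x₁ : ↥(fineDom ((ℓ + 1) ^ k) Ω₀c), ¬ inReg ((ℓ + 1) ^ k) Ωc x₁ →
      ∃ ν, D₁ ≤ |rpos ((ℓ + 1) ^ k) Ω₀c x₁ ν - rpos ((ℓ + 1) ^ k) Ω₀c x' ν|)
    (f : ↥(fineDom ((ℓ + 1) ^ k) Ω₀c) × ι → ℝ) (hfP : ∀ p, ¬ P p.1 → f p = 0) {V : ℝ} (hV : 1 ≤ V)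
    (hfV : lpv (vol d ℓ k)⁻¹ 2 f ≤ V * ‖f‖) (i : ι) :
    |((regOp F κ hn Ωc m2 (B1.aSeq a ((ℓ : ℝ) + 1) k * (((((ℓ + 1) ^ k : ℕ)) : ℝ) ^ (d + 1))⁻¹) (compField Ac))⁻¹
          *ᵥ (fun q : ↥(fineDom ((ℓ + 1) ^ k) Ωc) × ι => f (incl hn hsub q.1, q.2))) (x, i)
      - ((covOp (regWt ((ℓ + 1) ^ k) (fineDom ((ℓ + 1) ^ k) Ω₀c)) m2
          (B1.aSeq a ((ℓ : ℝ) + 1) k * (((((ℓ + 1) ^ k : ℕ)) : ℝ) ^ (d + 1))⁻¹)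
          (rBlkWt ((ℓ + 1) ^ k) Ω₀c (fineDom ((ℓ + 1) ^ k) Ω₀c)) (fieldLink F κ (acBond Ω₀c Ac))
          (contourTrans (fieldLink F κ (acBond Ω₀c Ac)) (rbaseEmb hn Ω₀c) (rstairContour hn Ω₀c)))⁻¹ *ᵥ f)
          (incl hn hsub x, i)|
      ≤ 2 ^ (d + 3) * Real.exp (17 / 4) * max (Real.sqrt (Fintype.card ι) * cG) 2
          * V * Real.exp (-((D + D₀ + D₁) / (2 * ((((ℓ + 1) ^ k : ℕ) : ℝ) * K)))) * ‖f‖ := by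
  classical
  have hK1 : 1 ≤ K := le_trans (by norm_num) hK8
  have hn2 : 2 ≤ (ℓ + 1) ^ k := by
    calc 2 ≤ ℓ + 1 := by omega
      _ = (ℓ + 1) ^ 1 := (pow_one _).symm
      _ ≤ (ℓ + 1) ^ k := Nat.pow_le_pow_right (Nat.succ_pos ℓ) hk
  have hnr : (1 : ℝ) ≤ ((((ℓ + 1) ^ k : ℕ)) : ℝ) := by exact_mod_cast hn
  have hn0 : (0 : ℝ) < ((((ℓ + 1) ^ k : ℕ)) : ℝ) := by positivity
  have hKr : (1 : ℝ) ≤ K := by exact_mod_cast hK1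
  have hM : (0 : ℝ) < ((((ℓ + 1) ^ k : ℕ)) : ℝ) * K := by positivity
  have hL : (1 : ℝ) < (ℓ : ℝ) + 1 := by
    have : (1 : ℝ) ≤ ℓ := by exact_mod_cast hℓ
    linarith
  have hak : 0 < B1.aSeq a ((ℓ : ℝ) + 1) k := B1.aSeq_pos ha hL hk
  have hak' : 0 < B1.aSeq a ((ℓ : ℝ) + 1) k * (((((ℓ + 1) ^ k : ℕ)) : ℝ) ^ (d + 1))⁻¹ := by positivity
  have hw : (0 : ℝ) < (vol d ℓ k)⁻¹ := inv_pos.2 (vol_pos d ℓ k)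
  have hN : (0 : ℝ) ≤ Real.sqrt (Fintype.card ι) := Real.sqrt_nonneg _
  have hγ0 : (0 : ℝ) ≤ max (Real.sqrt (Fintype.card ι) * cG) 2 := le_max_of_le_right zero_le_two
  -- the four chain inputs of the first family on `Ω₀` (its `atGreen`), and the support of `h_j`
  obtain ⟨Hγ, H0, Hgr, H2⟩ := chain_letter_inputs F κ hℓ hk hn Ω₀c hK8 ha hm Ac hcG hcK hn₀ hG h0 h1 hg hb
  have hsupp : ∀ (j : Fin (d + 1) → ℤ) (z : ↥(fineDom ((ℓ + 1) ^ k) Ω₀c)),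
      hCube (((((ℓ + 1) ^ k : ℕ)) : ℝ) * K) j (rpos ((ℓ + 1) ^ k) Ω₀c z) ≠ 0 → cubeS ℓ k Ω₀c K j z :=
    fun j z hz => cubeS_of_hCube_ne_zero ℓ k Ω₀c hK1 j z hz
  have heI : ∀ j : Fin (d + 1) → ℤ, Function.Injective (incl hn (subLabels_subset Ω₀c K j)) :=
    fun j => incl_injective hn _
  -- a cube interior to `Ω` is interior to `Ω₀`
  have hgood₀ : ∀ {j : Fin (d + 1) → ℤ}, cubeLabels K j ⊆ Ωc → cubeLabels K j ⊆ Ω₀c := fun h => h.trans hsub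
  -- the first family's letters at the cubes interior to `Ω` are `Ω₀`'s chain letters
  have hL2 : ∀ {j : Fin (d + 1) → ℤ} (hj : cubeLabels K j ⊆ Ωc),
      opK (cutWt (cubeS ℓ k Ω₀c K j) (regWt ((ℓ + 1) ^ k) (fineDom ((ℓ + 1) ^ k) Ω₀c))) m2
          (B1.aSeq a ((ℓ : ℝ) + 1) k * (((((ℓ + 1) ^ k : ℕ)) : ℝ) ^ (d + 1))⁻¹)
          (rBlkWt ((ℓ + 1) ^ k) Ω₀c (fineDom ((ℓ + 1) ^ k) Ω₀c))
          (cubeW F κ ℓ k Ω₀c K (atField₂ ℓ k Ω₀c Ωc K Ac j) j) (cubeT F κ ℓ k Ω₀c K (atField₂ ℓ k Ω₀c Ωc K Ac j) j)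
          (fun z => hCube (((((ℓ + 1) ^ k : ℕ)) : ℝ) * K) j (rpos ((ℓ + 1) ^ k) Ω₀c z))
        * atGreen₂ F κ ℓ k Ω₀c Ωc hsub K Ac a m2 j
        * mulH (ι := ι) (fun z => hCube (((((ℓ + 1) ^ k : ℕ)) : ℝ) * K) j (rpos ((ℓ + 1) ^ k) Ω₀c z))
      = chainLetter F κ ℓ k Ω₀c K Ac a m2 j := by
    intro j hj
    dsimp only [chainLetter]
    rw [atField₂_good ℓ k Ω₀c Ωc K Ac hj, atGreen₂_good F κ ℓ k Ω₀c Ωc hsub K Ac a m2 hj]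
  have hLΩ : ∀ {j : Fin (d + 1) → ℤ} (hj : cubeLabels K j ⊆ Ωc),
      opK (cutWt (cubeS ℓ k Ω₀c K j) (cOmega ℓ k Ω₀c Ωc)) m2
          (B1.aSeq a ((ℓ : ℝ) + 1) k * (((((ℓ + 1) ^ k : ℕ)) : ℝ) ^ (d + 1))⁻¹)
          (rBlkWt ((ℓ + 1) ^ k) Ω₀c (fineDom ((ℓ + 1) ^ k) Ω₀c))
          (cubeW F κ ℓ k Ω₀c K (atField₂ ℓ k Ω₀c Ωc K Ac j) j) (cubeT F κ ℓ k Ω₀c K (atField₂ ℓ k Ω₀c Ωc K Ac j) j)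
          (fun z => hCube (((((ℓ + 1) ^ k : ℕ)) : ℝ) * K) j (rpos ((ℓ + 1) ^ k) Ω₀c z))
        * atGreenΩ F κ ℓ k Ω₀c Ωc hsub K Ac a m2 j
        * mulH (ι := ι) (fun z => hCube (((((ℓ + 1) ^ k : ℕ)) : ℝ) * K) j (rpos ((ℓ + 1) ^ k) Ω₀c z))
      = chainLetter F κ ℓ k Ω₀c K Ac a m2 j := by
    intro j hj
    dsimp only [chainLetter]
    exact letterΩ_b_eq F κ ℓ k Ω₀c Ωc hsub K Ac a m2 hj _ (hsupp j)
  -- the first family's `‖·‖₂` letter at a cube not interior to `Ω`: Lemma 2.1 on `Ω₀ ∩ □̂_j`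
  have hLI : ∀ {j : Fin (d + 1) → ℤ} (hj : ¬ cubeLabels K j ⊆ Ωc) (g : ↥(fineDom ((ℓ + 1) ^ k) Ω₀c) × ι → ℝ),
      lpv (vol d ℓ k)⁻¹ 2 ((opK (cutWt (cubeS ℓ k Ω₀c K j) (regWt ((ℓ + 1) ^ k) (fineDom ((ℓ + 1) ^ k) Ω₀c))) m2
          (B1.aSeq a ((ℓ : ℝ) + 1) k * (((((ℓ + 1) ^ k : ℕ)) : ℝ) ^ (d + 1))⁻¹)
          (rBlkWt ((ℓ + 1) ^ k) Ω₀c (fineDom ((ℓ + 1) ^ k) Ω₀c))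
          (cubeW F κ ℓ k Ω₀c K (atField₂ ℓ k Ω₀c Ωc K Ac j) j) (cubeT F κ ℓ k Ω₀c K (atField₂ ℓ k Ω₀c Ωc K Ac j) j)
          (fun z => hCube (((((ℓ + 1) ^ k : ℕ)) : ℝ) * K) j (rpos ((ℓ + 1) ^ k) Ω₀c z))
        * atGreen₂ F κ ℓ k Ω₀c Ωc hsub K Ac a m2 j
        * mulH (ι := ι) (fun z => hCube (((((ℓ + 1) ^ k : ℕ)) : ℝ) * K) j (rpos ((ℓ + 1) ^ k) Ω₀c z))) *ᵥ g)
      ≤ Real.sqrt (Fintype.card ι) * cK * lpv (vol d ℓ k)⁻¹ 2 g := by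
    intro j hj g
    rw [atField₂_bad ℓ k Ω₀c Ωc K Ac hj, atGreen₂_bad F κ ℓ k Ω₀c Ωc hsub K Ac a m2 hj,
      cube_letter_b_I F κ ℓ k Ω₀c K m2 _ _ j _ (hsupp j), hCube_incl ℓ k Ω₀c K j, lpv_pad_mulVec (heI j) two_pos]
    have hin := hb j (fun q : ↥(fineDom ((ℓ + 1) ^ k) (subLabels Ω₀c K j)) × ι =>
      g (incl hn (subLabels_subset Ω₀c K j) q.1, q.2))
    rw [Matrix.mulVec_mulVec, Matrix.mulVec_mulVec] at hin
    refine (lpv_bound_of_lpW_bound d ℓ k two_pos le_rfl hcK hin).trans ?_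
    exact mul_le_mul_of_nonneg_left (lpv_res_le (heI j) hw.le two_pos g) (by positivity)
  -- `R₀`: the cubes seeing `x` and their `n₀`-neighbours are interior to `Ω`
  have hR₀' : ∀ i' ∈ labels (((((ℓ + 1) ^ k : ℕ)) : ℝ) * K) ((ℓ + 1) ^ k) Ω₀c,
      hCube (((((ℓ + 1) ^ k : ℕ)) : ℝ) * K) i' (rpos ((ℓ + 1) ^ k) Ω₀c (incl hn hsub x)) ≠ 0 →
      ∀ j ∈ labels (((((ℓ + 1) ^ k : ℕ)) : ℝ) * K) ((ℓ + 1) ^ k) Ω₀c, (∀ ν, |i' ν - j ν| ≤ (n₀ : ℤ)) →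
      cubeLabels K j ⊆ Ωc :=
    fun i' _ hi' j _ hij => good_of_R0 ℓ k Ωc hK8 n₀ x hR₀ i' hi' j hij
  -- THE CHAIN
  have main := ineq112_value_lp_apply (X := ↥(fineDom ((ℓ + 1) ^ k) Ω₀c)) (Y := ↥Ω₀c) (κ := ι) hM
    (rpos ((ℓ + 1) ^ k) Ω₀c) (regWt ((ℓ + 1) ^ k) (fineDom ((ℓ + 1) ^ k) Ω₀c)) m2
    (B1.aSeq a ((ℓ : ℝ) + 1) k * (((((ℓ + 1) ^ k : ℕ)) : ℝ) ^ (d + 1))⁻¹)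
    (rBlkWt ((ℓ + 1) ^ k) Ω₀c (fineDom ((ℓ + 1) ^ k) Ω₀c)) (fieldLink F κ (acBond Ω₀c Ac))
    (contourTrans (fieldLink F κ (acBond Ω₀c Ac)) (rbaseEmb hn Ω₀c) (rstairContour hn Ω₀c))
    (fun x z' h μ => regWt_local hn Ω₀c hK8 x z' h μ)
    (fun y x z' h h' μ => rBlkWt_local hn Ω₀c hK8 y x z' h h' μ)
    (labels (((((ℓ + 1) ^ k : ℕ)) : ℝ) * K) ((ℓ + 1) ^ k) Ω₀c) (fun j z h => labels_complete Ω₀c _ j z h)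
    (fun j => cubeS ℓ k Ω₀c K j) (fun j z hz => inBox_of_near hn hK1 j z hz)
    (fun j z hz μ => abs_rpos_sub_le_of_cubeS hn Ω₀c K j z hz μ)
    (fun j y z z' hz hz' => inBox_iff_of_rBlkWt _ _ hz hz')
    (fun j => cubeW F κ ℓ k Ω₀c K (atField₂ ℓ k Ω₀c Ωc K Ac j) j)
    (fun j => cubeT F κ ℓ k Ω₀c K (atField₂ ℓ k Ω₀c Ωc K Ac j) j)
    (fun j x z' hx hz' => cubeW_window F κ ℓ k Ω₀c hK1 j hx hz' (atField₂_core ℓ k Ω₀c Ωc Ac hK1 j x z' hx hz'))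
    (fun j y x hyx hx => cubeT_window F κ ℓ k Ω₀c hK1 hK4 j
      (fun u v hu hv _ => atField₂_core ℓ k Ω₀c Ωc Ac hK1 j u v hu hv) y x hyx hx)
    (inReg ((ℓ + 1) ^ k) Ωc)
    (atGreen₂ F κ ℓ k Ω₀c Ωc hsub K Ac a m2) (fun j _ => atGreen₂_mul F κ ℓ k Ω₀c Ωc hsub K Ac hℓ hk ha hm j)
    (atGreenΩ F κ ℓ k Ω₀c Ωc hsub K Ac a m2) (fun j _ => atGreenΩ_mul F κ ℓ k Ω₀c Ωc hsub K Ac hℓ hk ha hm j)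
    (pairGreen F κ hn Ω₀c Ωc hsub m2 _ (compField Ac)) (pairGreen_mul F κ hn Ω₀c Ωc hsub hak' hm (compField Ac))
    _ (green_mul_op hn Ω₀c F κ hak' hm (regWt ((ℓ + 1) ^ k) (fineDom ((ℓ + 1) ^ k) Ω₀c)) (regWt_nonneg _ _)
      (fun _ _ _ => rfl) (acBond Ω₀c Ac))
    (fun j => cubeLabels K j ⊆ Ωc) (γ := max (Real.sqrt (Fintype.card ι) * cG) 2)
    (β := Real.sqrt (Fintype.card ι) * cK) (w := (vol d ℓ k)⁻¹) hn₀ hw hγ0 (by positivity)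
    -- `γ`, both families
    (fun jj hj => by
      rw [atGreen₂_good F κ ℓ k Ω₀c Ωc hsub K Ac a m2 hj]
      exact Hγ jj.1 (hgood₀ hj))
    (fun jj hj => by
      refine (norm_atGreenΩ_le F κ ℓ k Ω₀c Ωc hsub K Ac hn2 a hm hj).trans (max_le_max ?_ ?_)
      · rw [subFieldB_atField ℓ k Ω₀c Ac hK1 (hgood₀ hj)]
        exact linfty_opNorm_le_of_supN _ hcG (hG jj.1 (hgood₀ hj))
      · rw [div_le_iff₀ (by positivity)]
        nlinarith)
    -- `β`, both families
    (fun jj hj => by rw [hL2 hj]; exact H0 jj.1 (hgood₀ hj))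
    (fun jj hj => by rw [hLΩ hj]; exact H0 jj.1 (hgood₀ hj))
    -- graded, both families
    (fun jj hj t ht1 ht2 g => by rw [hL2 hj]; exact Hgr jj.1 (hgood₀ hj) t ht1 ht2 g)
    (fun jj hj t ht1 ht2 g => by rw [hLΩ hj]; exact Hgr jj.1 (hgood₀ hj) t ht1 ht2 g)
    -- `‖·‖₂` at every cube, both families
    (fun jj g => by
      by_cases hj : cubeLabels K jj.1 ⊆ Ωc
      · rw [hL2 hj]; exact H2 jj.1 g
      · exact hLI hj g)
    (fun jj g => by
      by_cases hj : cubeLabels K jj.1 ⊆ Ωc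
      · rw [hLΩ hj]; exact H2 jj.1 g
      · exact lpv_two_letterΩ_bad_le F κ ℓ k Ω₀c Ωc hsub K Ac hK1 hj hcK (hbΩ₁ jj.1) (hbΩ₂ jj.1) g)
    h3 (incl hn hsub x) hR₀' P hD hD₀ hD₁ f hfP hV hfV i
  -- read the entry: `(G f)(x) = (G_k(Ω,A)(f|_Ω))(x)`
  rw [Matrix.sub_mulVec, Pi.sub_apply, pairGreen_mulVec_incl] at main
  refine main.trans (le_of_eq ?_)
  ring_nf

end Inputs

/-! ## §2. (1.11)–(1.12), value member, hypothesis-free -/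

section Standard

variable {ι : Type} [Fintype ι] [DecidableEq ι]

/-- **[B4] THEOREM p. 573, (1.11)–(1.12) — THE δG CLAUSE, VALUE MEMBER, FOR A GENERAL PAIR `Ω ⊂ Ω₀` UNDER `R₀`,
HYPOTHESIS-FREE** (the print: «If Ω ⊂ Ω₀, then for δG_k(Ω,Ω₀,A) = G_k(Ω,A) − G_k(Ω₀,A) (1.11) we have the
inequalities (1.9), (1.10) (with the same restrictions on x, x′) with the additional factor (1.12) on the right hand
sides»).  There are a cube size `K ≥ 8` (`8 ∣ K`) and `c₀ > 0`
(depending on `d`, `N`, the flow, `L` and the windows only) such that for every regularity pair `(c, β)`, `β > 0`,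
there is `e₁ > 0` with: for every step `k ≥ 1`, every `a ∈ [a₋, a₊]`, `0 ≤ m² ≤ m₊²`, every pair `Ω ⊆ Ω₀` of finite
unions of `K`-blocks, every `A` regular (1.7) on `Ω₀` with `0 < e ≤ e₁`, every site `x ∈ Ω` with
`dist_∞(B(x), Ω^c) > K(d+3)` unit lengths (`R₀`, label form), every `f : Ω₀ → ℝ^N` supported in a set `P` with
`D ≤ dist_∞(x, P)`, `D₀ ≤ dist_∞(x, Ω^c)`, `D₁ ≤ dist_∞(P, Ω^c)` (fine units; `Ω^c` = the sites of `Ω₀` outside `Ω`)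
and `‖f‖_{2,η} ≤ V‖f‖_∞`, every colour `i`:
`|(G_k(Ω,A)(f|_Ω))(x)_i − (G_k(Ω₀,A)f)(x)_i| ≤ c₀·V·exp(−(D + D₀ + D₁)/(2nK))·‖f‖_∞` — for `f` supported in `Ω`
the left side is `|(δG_k(Ω,Ω₀,A)f)(x)_i|`, and the right side is (1.10)'s decay in `dist(x, supp f)` times the
additional decays in `dist(x, Ω^c)` and `dist(supp f, Ω^c)` — the factor (1.12) — at the rate `δ₀ = 1/(2K)` per
`η`-unit of length.  `G_k(R,A) = B4Lemma21Region.regionOp` at the running coefficient `a_k`.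
[cite: Balaban1983RegularityDecay, Theorem p.573 (1.10)–(1.12); §2 pp.575–579 (2.13), (2.18)–(2.22), p.579 «Similarly
the remaining inequalities can be proved»; Lemma 2.1 p.577; Lemma 2.2 pp.577–578] -/
theorem thm112_value_region (F : OrthFlow ι) {ℓ₁ : ℝ} (hℓ₁ : 0 ≤ ℓ₁)
    (hLip : ∀ t (v : ι → ℝ), ((F.U t - 1) *ᵥ v) ⬝ᵥ ((F.U t - 1) *ᵥ v) ≤ (ℓ₁ * t) ^ 2 * (v ⬝ᵥ v))
    (d ℓ : ℕ) (hℓ : 1 ≤ ℓ) (amin aplus m2plus : ℝ) (ha : 0 < amin) :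
    ∃ K : ℕ, 8 ≤ K ∧ 8 ∣ K ∧ ∃ c₀ : ℝ, 0 < c₀ ∧ ∀ (creg β : ℝ), 0 ≤ creg → 0 < β →
      ∃ e₁ : ℝ, 0 < e₁ ∧ ∀ (k : ℕ), 1 ≤ k → ∀ (hn : 1 ≤ (ℓ + 1) ^ k) (a m2 : ℝ),
      amin ≤ a → a ≤ aplus → 0 ≤ m2 → m2 ≤ m2plus →
      ∀ (Ω₀c Ωc : Finset (Fin (d + 1) → ℤ)), IsBlockUnion K Ω₀c → IsBlockUnion K Ωc → ∀ (hsub : Ωc ⊆ Ω₀c)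
      (Ac : (Fin (d + 1) → ℤ) → Fin (d + 1) → ℝ) (e : ℝ), 0 < e → e ≤ e₁ →
        (∀ x ∈ fineDom ((ℓ + 1) ^ k) Ω₀c, ∀ μ ν : Fin (d + 1),
          |Ac (x + e1 μ) ν - Ac x ν| ≤ creg * e ^ (β - 1) / ((ℓ + 1) ^ k : ℕ)) →
      ∀ (x : ↥(fineDom ((ℓ + 1) ^ k) Ωc)),
        (∀ y : Fin (d + 1) → ℤ, (∀ μ, |y μ - blk ((ℓ + 1) ^ k) x.1 μ| ≤ (K : ℤ) * (d + 3)) → y ∈ Ωc) →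
      ∀ (P : ↥(fineDom ((ℓ + 1) ^ k) Ω₀c) → Prop) [DecidablePred P] (D D₀ D₁ : ℝ),
        (∀ x', P x' → ∃ μ, D ≤ |rpos ((ℓ + 1) ^ k) Ω₀c (incl hn hsub x) μ - rpos ((ℓ + 1) ^ k) Ω₀c x' μ|) →
        (∀ x₁ : ↥(fineDom ((ℓ + 1) ^ k) Ω₀c), ¬ inReg ((ℓ + 1) ^ k) Ωc x₁ →
          ∃ μ, D₀ ≤ |rpos ((ℓ + 1) ^ k) Ω₀c (incl hn hsub x) μ - rpos ((ℓ + 1) ^ k) Ω₀c x₁ μ|) →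
        (∀ x', P x' → ∀ x₁ : ↥(fineDom ((ℓ + 1) ^ k) Ω₀c), ¬ inReg ((ℓ + 1) ^ k) Ωc x₁ →
          ∃ μ, D₁ ≤ |rpos ((ℓ + 1) ^ k) Ω₀c x₁ μ - rpos ((ℓ + 1) ^ k) Ω₀c x' μ|) →
      ∀ (f : ↥(fineDom ((ℓ + 1) ^ k) Ω₀c) × ι → ℝ), (∀ p, ¬ P p.1 → f p = 0) →
      ∀ (V : ℝ), 1 ≤ V → lpv (vol d ℓ k)⁻¹ 2 f ≤ V * ‖f‖ →
      ∀ i : ι,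
        |((regionOp F e hn (B1.aSeq a ((ℓ : ℝ) + 1) k) m2 Ωc Ac)⁻¹
              *ᵥ (fun q : ↥(fineDom ((ℓ + 1) ^ k) Ωc) × ι => f (incl hn hsub q.1, q.2))) (x, i)
          - ((regionOp F e hn (B1.aSeq a ((ℓ : ℝ) + 1) k) m2 Ω₀c Ac)⁻¹ *ᵥ f) (incl hn hsub x, i)|
          ≤ c₀ * V * Real.exp (-((D + D₀ + D₁) / (2 * ((((ℓ + 1) ^ k : ℕ) : ℝ) * K)))) * ‖f‖ := by
  -- the constants of the per-cube inputs (Lemma 2.2 at `Ã_j`, (2.20), (2.21), the graded factor; Lemma 2.1)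
  obtain ⟨C₁, hC₁, h₁⟩ := lemma22_sup_cubeField F hℓ₁ hLip d ℓ hℓ amin aplus m2plus ha
  obtain ⟨C₂, hC₂, h₂⟩ := eq220_cubeField_std F hℓ₁ hLip d ℓ hℓ amin aplus m2plus ha
  have hp₁ : (d : ℝ) + 1 < 2 * ((d : ℝ) + 1) := by
    have : (0 : ℝ) ≤ d := Nat.cast_nonneg d
    linarith
  obtain ⟨C₃, hC₃, h₃⟩ := eq221_cubeField F hℓ₁ hLip d ℓ hℓ amin aplus m2plus ha hp₁
  obtain ⟨C₄, hC₄, h₄⟩ := eq221_psup_cubeField_std F hℓ₁ hLip d ℓ hℓ amin aplus m2plus ha hp₁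
  have hs : 0 ≤ ((d : ℝ) + 1) * (D1 hprof + D2 hprof) := by
    have := D1_nonneg contDiff_hprof hasCompactSupport_hprof
    have := D2_nonneg contDiff_hprof hasCompactSupport_hprof
    positivity
  have hγ₀ : 0 < min 2 (3 / 4 * amin) / 4 := div_pos (lt_min two_pos (by linarith)) four_pos
  set C₅ : ℝ := (2 * ((d : ℝ) + 1) * (Real.sqrt (min 2 (3 / 4 * amin) / 4))⁻¹
      + (1 + |aplus|) * (min 2 (3 / 4 * amin) / 4)⁻¹) * (((d : ℝ) + 1) * (D1 hprof + D2 hprof)) with hC₅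
  have hC₅0 : 0 ≤ C₅ := by
    have : 0 ≤ (Real.sqrt (min 2 (3 / 4 * amin) / 4))⁻¹ := inv_nonneg.2 (Real.sqrt_nonneg _)
    have : 0 ≤ (min 2 (3 / 4 * amin) / 4)⁻¹ := inv_nonneg.2 hγ₀.le
    positivity
  set Cm : ℝ := C₂ + C₃ + C₄ + C₅ with hCm
  have hCm0 : 0 ≤ Cm := by positivity
  -- the cube size: `3^{d+1}·√N·C_max/K ≤ e^{−1}`, `8 ∣ K`
  set X : ℝ := (3 : ℝ) ^ (d + 1) * Real.sqrt (Fintype.card ι) * Cm * Real.exp 1 with hX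
  have hX0 : 0 ≤ X := by positivity
  set K : ℕ := 8 * (⌈X⌉₊ + 1) with hK
  have hK8 : 8 ≤ K := by omega
  have h8 : 8 ∣ K := ⟨⌈X⌉₊ + 1, rfl⟩
  have hK4 : 4 ∣ K := ⟨2 * (⌈X⌉₊ + 1), by omega⟩
  have hK2 : 2 ≤ K := by omega
  have hK1 : 1 ≤ K := by omega
  have hKr : (0 : ℝ) < K := by exact_mod_cast hK1
  have hKX : X ≤ K := by
    refine (Nat.le_ceil X).trans ?_
    rw [hK]
    push_cast
    linarith [(Nat.cast_nonneg ⌈X⌉₊ : (0 : ℝ) ≤ ⌈X⌉₊)]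
  set cK : ℝ := Cm / K with hcK_def
  have hcK : 0 ≤ cK := div_nonneg hCm0 hKr.le
  have h3 : (3 : ℝ) ^ (d + 1) * (Real.sqrt (Fintype.card ι) * cK) ≤ Real.exp (-1) := by
    have hexp : Real.exp 1 * Real.exp (-1) = 1 := by rw [← Real.exp_add]; norm_num
    have e : (3 : ℝ) ^ (d + 1) * (Real.sqrt (Fintype.card ι) * cK) = X / K * Real.exp (-1) := by
      rw [hcK_def, hX]
      calc (3 : ℝ) ^ (d + 1) * (Real.sqrt (Fintype.card ι) * (Cm / K))
          = (3 : ℝ) ^ (d + 1) * Real.sqrt (Fintype.card ι) * Cm / K * (Real.exp 1 * Real.exp (-1)) := by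
            rw [hexp]; ring
        _ = (3 : ℝ) ^ (d + 1) * Real.sqrt (Fintype.card ι) * Cm * Real.exp 1 / K * Real.exp (-1) := by ring
    rw [e]
    have : X / K ≤ 1 := div_le_one_of_le₀ hKX (Nat.cast_nonneg K)
    calc X / K * Real.exp (-1) ≤ 1 * Real.exp (-1) := mul_le_mul_of_nonneg_right this (Real.exp_pos _).le
      _ = Real.exp (-1) := one_mul _
  have hCle : ∀ {C : ℝ}, C ≤ Cm → C / K ≤ cK := fun h => div_le_div_of_nonneg_right h hKr.le
  have hC₂le : C₂ / K ≤ cK := hCle (by rw [hCm]; linarith)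
  have hC₃le : C₃ / K ≤ cK := hCle (by rw [hCm]; linarith)
  have hC₄le : C₄ / K ≤ cK := hCle (by rw [hCm]; linarith)
  have hC₅le : C₅ / K ≤ cK := hCle (by rw [hCm]; linarith)
  -- the constant `c₀`
  set c₀ : ℝ := 2 ^ (d + 3) * Real.exp (17 / 4) * max (Real.sqrt (Fintype.card ι) * C₁) 2 with hc₀
  have hc₀0 : 0 < c₀ := by
    have : (0 : ℝ) < max (Real.sqrt (Fintype.card ι) * C₁) 2 := lt_max_of_lt_right two_pos
    positivity
  refine ⟨K, hK8, h8, c₀, hc₀0, fun creg β hcreg hβ => ?_⟩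
  -- «for e sufficiently small»
  obtain ⟨e₁, he₁, h₁'⟩ := h₁ creg β hcreg hβ (2 * K) K hK1
  obtain ⟨e₂, he₂, h₂'⟩ := h₂ creg β hcreg hβ K hK2
  obtain ⟨e₃, he₃, h₃'⟩ := h₃ creg β hcreg hβ (2 * K) K hK2
  obtain ⟨e₄, he₄, h₄'⟩ := h₄ creg β hcreg hβ K hK2
  obtain ⟨e₅, he₅, h₅'⟩ := cubeField_threshold d (c := 0) (aplus := aplus) hℓ₁ le_rfl ha hcreg hβ 1 K
  refine ⟨min (min (min e₁ e₂) (min e₃ e₄)) e₅, lt_min (lt_min (lt_min he₁ he₂) (lt_min he₃ he₄)) he₅, ?_⟩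
  intro k hk hn a m2 ea1 ea2 em1 em2 Ω₀c Ωc hΩ₀ hΩ hsub Ac e he hle h17 x hxR P _ D D₀ D₁ hD hD₀ hD₁ f hfP V hV hfV i
  have hle₁ : e ≤ e₁ := hle.trans ((min_le_left _ _).trans ((min_le_left _ _).trans (min_le_left _ _)))
  have hle₂ : e ≤ e₂ := hle.trans ((min_le_left _ _).trans ((min_le_left _ _).trans (min_le_right _ _)))
  have hle₃ : e ≤ e₃ := hle.trans ((min_le_left _ _).trans ((min_le_right _ _).trans (min_le_left _ _)))
  have hle₄ : e ≤ e₄ := hle.trans ((min_le_left _ _).trans ((min_le_right _ _).trans (min_le_right _ _)))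
  have hle₅ : e ≤ e₅ := hle.trans (min_le_right _ _)
  have hn2 : 2 ≤ (ℓ + 1) ^ k := by
    calc 2 ≤ ℓ + 1 := by omega
      _ = (ℓ + 1) ^ 1 := (pow_one _).symm
      _ ≤ (ℓ + 1) ^ k := Nat.pow_le_pow_right (Nat.succ_pos ℓ) hk
  have hnK : 16 ≤ (ℓ + 1) ^ k * K := le_trans (by norm_num) (Nat.mul_le_mul hn2 hK8)
  have hnK3 : 3 ≤ (ℓ + 1) ^ k * K := le_trans (by norm_num) hnK
  have ha' : 0 < a := lt_of_lt_of_le ha ea1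
  have hL : (1 : ℝ) < (ℓ : ℝ) + 1 := by
    have : (1 : ℝ) ≤ ℓ := by exact_mod_cast hℓ
    linarith
  have hak : 0 < B1.aSeq a ((ℓ : ℝ) + 1) k := B1.aSeq_pos ha' hL hk
  obtain ⟨hak1, hak2⟩ := aSeq_window hℓ hk ha ea1 ea2
  have hvol : 0 ≤ (vol d ℓ k)⁻¹ ^ (2 : ℝ)⁻¹ := Real.rpow_nonneg (inv_nonneg.2 (vol_pos d ℓ k).le) _
  -- the standard box data
  have hM1 : ∀ _i : Fin (d + 1), 1 ≤ 2 * K := fun _ => by omega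
  have hMS : ∀ _i : Fin (d + 1), 2 * K ≤ 2 * K := fun _ => le_rfl
  have hKM : ∀ _i : Fin (d + 1), K ∣ 2 * K := fun _ => Dvd.intro_left 2 rfl
  have hj1 : ∀ _i : Fin (d + 1), (1 : ℤ) ≤ 1 := fun _ => le_rfl
  have hj2 : ∀ _i : Fin (d + 1), (K : ℤ) * (1 + 1) ≤ ((2 * K : ℕ) : ℤ) := fun _ => by push_cast; omega
  -- Lemma 2.1's `‖·‖_{2,2}` letter on a finite union `R ⊆ Ω₀` of `K`-blocks (the three kinds of sub-regions)
  have hbR : ∀ (R : Finset (Fin (d + 1) → ℤ)), R ⊆ Ω₀c → IsBlockUnion K R → ∀ (j : Fin (d + 1) → ℤ)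
      (Φ : ↥(fineDom ((ℓ + 1) ^ k) R) × ι → ℝ),
      lpW d ℓ k 2 (opK (regWt ((ℓ + 1) ^ k) (fineDom ((ℓ + 1) ^ k) (R))) m2
            (B1.aSeq a ((ℓ : ℝ) + 1) k * (((((ℓ + 1) ^ k : ℕ)) : ℝ) ^ (d + 1))⁻¹)
            (rBlkWt ((ℓ + 1) ^ k) (R) (fineDom ((ℓ + 1) ^ k) (R)))
            (fieldLink F (e / ((ℓ + 1) ^ k : ℕ)) (acBond (R) Ac))
            (contourTrans (fieldLink F (e / ((ℓ + 1) ^ k : ℕ)) (acBond (R) Ac)) (rbaseEmb hn (R))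
              (rstairContour hn (R)))
            (fun a : ↥(fineDom ((ℓ + 1) ^ k) (R)) => hZ ((ℓ + 1) ^ k) K j a.1)
          *ᵥ ((covOp (regWt ((ℓ + 1) ^ k) (fineDom ((ℓ + 1) ^ k) (R))) m2
                (B1.aSeq a ((ℓ : ℝ) + 1) k * (((((ℓ + 1) ^ k : ℕ)) : ℝ) ^ (d + 1))⁻¹)
                (rBlkWt ((ℓ + 1) ^ k) (R) (fineDom ((ℓ + 1) ^ k) (R)))
                (fieldLink F (e / ((ℓ + 1) ^ k : ℕ)) (acBond (R) Ac))
                (contourTrans (fieldLink F (e / ((ℓ + 1) ^ k : ℕ)) (acBond (R) Ac)) (rbaseEmb hn (R))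
                  (rstairContour hn (R))))⁻¹
            *ᵥ (mulH (ι := ι) (fun a : ↥(fineDom ((ℓ + 1) ^ k) (R)) => hZ ((ℓ + 1) ^ k) K j a.1) *ᵥ Φ))) ≤ cK * lpW d ℓ k 2 Φ := by
    intro R hR hRB j Φ
    obtain ⟨_, hsm, _⟩ := h₅' e he hle₅ _ hak1 hak2
    have hsmall : ℓ₁ ^ 2 * (((d : ℝ) + 1) * creg * e ^ β) ^ 2 * ((d : ℝ) + 1)
        * (1 + B1.aSeq a ((ℓ : ℝ) + 1) k * ((d : ℝ) + 1)) ≤ min 2 (B1.aSeq a ((ℓ : ℝ) + 1) k) / 4 := by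
      simpa only [Nat.cast_one, mul_one] using hsm
    have hL := eq221_l2_region_hZ F hℓ₁ hLip he hn hak em1 R hcreg
      (fun y hy => h17 y (fineDom_mono hn hR hy)) hsmall hnK3 hRB j Φ
    have step : lpM 2 (kOpR F e hn (B1.aSeq a ((ℓ : ℝ) + 1) k) m2 R Ac (fun x => hZ ((ℓ + 1) ^ k) K j x.1)
        *ᵥ ((regionOp F e hn (B1.aSeq a ((ℓ : ℝ) + 1) k) m2 R Ac)⁻¹
          *ᵥ (mulH (ι := ι) (fun x : ↥(fineDom ((ℓ + 1) ^ k) R) => hZ ((ℓ + 1) ^ k) K j x.1) *ᵥ Φ)))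
        ≤ cK * lpM 2 Φ := by
      refine hL.trans (mul_le_mul_of_nonneg_right ?_ (lpM_nonneg 2 Φ))
      refine le_trans ?_ hC₅le
      rw [hC₅]
      calc (2 * ((d : ℝ) + 1) * (Real.sqrt (min 2 (B1.aSeq a ((ℓ : ℝ) + 1) k) / 4 + m2))⁻¹
            + (1 + B1.aSeq a ((ℓ : ℝ) + 1) k) * (min 2 (B1.aSeq a ((ℓ : ℝ) + 1) k) / 4 + m2)⁻¹)
            * (((d : ℝ) + 1) * (D1 hprof + D2 hprof)) / K
          = (2 * ((d : ℝ) + 1) * (Real.sqrt (min 2 (B1.aSeq a ((ℓ : ℝ) + 1) k) / 4 + m2))⁻¹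
            + (1 + B1.aSeq a ((ℓ : ℝ) + 1) k) * (min 2 (B1.aSeq a ((ℓ : ℝ) + 1) k) / 4 + m2)⁻¹)
            * (((d : ℝ) + 1) * (D1 hprof + D2 hprof)) * (K : ℝ)⁻¹ := div_eq_mul_inv _ _
        _ ≤ (2 * ((d : ℝ) + 1) * (Real.sqrt (min 2 (3 / 4 * amin) / 4))⁻¹
            + (1 + |aplus|) * (min 2 (3 / 4 * amin) / 4)⁻¹) * (((d : ℝ) + 1) * (D1 hprof + D2 hprof))
            * (K : ℝ)⁻¹ := mul_le_mul_of_nonneg_right (l2_const_le d ha hak1 hak2 em1 hs) (inv_nonneg.2 hKr.le)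
        _ = _ := (div_eq_mul_inv _ _).symm
    show (vol d ℓ k)⁻¹ ^ (2 : ℝ)⁻¹ * lpM 2 _ ≤ cK * ((vol d ℓ k)⁻¹ ^ (2 : ℝ)⁻¹ * lpM 2 Φ)
    calc (vol d ℓ k)⁻¹ ^ (2 : ℝ)⁻¹ * lpM 2 _ ≤ (vol d ℓ k)⁻¹ ^ (2 : ℝ)⁻¹ * (cK * lpM 2 Φ) :=
          mul_le_mul_of_nonneg_left step hvol
      _ = cK * ((vol d ℓ k)⁻¹ ^ (2 : ℝ)⁻¹ * lpM 2 Φ) := by ring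
  -- the other two kinds of sub-regions are finite unions of `K`-blocks inside `Ω₀`
  have hsd : ∀ j : Fin (d + 1) → ℤ, IsBlockUnion K (subLabels Ω₀c K j \ (Ωc ∩ cubeLabels K j)) := by
    intro j y hy z hz
    rw [Finset.mem_sdiff] at hy ⊢
    refine ⟨isBlockUnion_subLabels Ω₀c hK1 hΩ₀ j hy.1 hz, fun hzc => hy.2 ?_⟩
    exact isBlockUnion_subLabels Ωc hK1 hΩ j hzc hz.symm
  -- the main chain with the inputs discharged
  have main := thm112_value_region_of_inputs F (e / ((ℓ + 1) ^ k : ℕ)) hℓ hk hn Ω₀c Ωc hsub hK8 hK4 ha' em1 Ac hC₁.le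
    hcK (n₀ := d + 1) (Nat.succ_pos d)
    -- Lemma 2.2 (2.17), sup member, at `Ã_j`
    (fun j hj Φ => (h₁' k hk hn hnK a m2 ea1 ea2 em1 em2 (fun _ => 2 * K) hM1 hMS (fun _ => 1) hj1 hj2
      (AcS ℓ k K Ac j) e he hle₁ (regular_AcS h17 hj) Φ).1)
    -- (2.20)
    (fun j hj Φ => (h₂' k hk hn hnK a m2 ea1 ea2 em1 em2 (AcS ℓ k K Ac j) e he hle₂ (regular_AcS h17 hj) Φ).trans
      (mul_le_mul_of_nonneg_right hC₂le (supN_nonneg Φ)))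
    -- the graded factor `‖·‖_{∞,p₁}` of (2.21)
    (fun j hj p hp Φ => by
      have hp' : 2 * ((d : ℝ) + 1) ≤ p := by push_cast at hp; linarith
      exact (h₄' k hk hn hnK a m2 ea1 ea2 em1 em2 (AcS ℓ k K Ac j) e he hle₄ (regular_AcS h17 hj) p hp' Φ).trans
        (mul_le_mul_of_nonneg_right hC₄le (lpW_nonneg d ℓ k p Φ)))
    -- (2.21)
    (fun j hj p q hp hpq hdiff Φ => by
      have hdiff' : p⁻¹ - q⁻¹ ≤ (2 * ((d : ℝ) + 1))⁻¹ := by push_cast at hdiff; exact hdiff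
      exact (h₃' k hk hn hnK a m2 ea1 ea2 em1 em2 (fun _ => 2 * K) hM1 hMS hKM (fun _ => 1) hj1 hj2
        (AcS ℓ k K Ac j) e he hle₃ (regular_AcS h17 hj) p q hp hpq hdiff' Φ).trans
        (mul_le_mul_of_nonneg_right hC₃le (lpW_nonneg d ℓ k p Φ)))
    -- Lemma 2.1's `‖·‖_{2,2}` on `Ω₀ ∩ □̂_j`, on `Ω ∩ □̂_j`, on `(Ω₀∖Ω) ∩ □̂_j`
    (fun j Φ => hbR (subLabels Ω₀c K j) (subLabels_subset Ω₀c K j) (isBlockUnion_subLabels Ω₀c hK1 hΩ₀ j) j Φ)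
    (fun j Φ => hbR (Ωc ∩ cubeLabels K j) ((subLabels_subset Ωc K j).trans hsub)
      (isBlockUnion_subLabels Ωc hK1 hΩ j) j Φ)
    (fun j Φ => hbR (subLabels Ω₀c K j \ (Ωc ∩ cubeLabels K j))
      (Finset.sdiff_subset.trans (subLabels_subset Ω₀c K j)) (hsd j) j Φ)
    h3 x
    (fun y hy => hxR y fun μ => by have h := hy μ; push_cast at h ⊢; linarith)
    P hD hD₀ hD₁ f hfP hV hfV i
  have hreg : ∀ (R : Finset (Fin (d + 1) → ℤ)), regionOp F e hn (B1.aSeq a ((ℓ : ℝ) + 1) k) m2 R Ac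
      = covOp (regWt ((ℓ + 1) ^ k) (fineDom ((ℓ + 1) ^ k) R)) m2
          (B1.aSeq a ((ℓ : ℝ) + 1) k * (((((ℓ + 1) ^ k : ℕ)) : ℝ) ^ (d + 1))⁻¹)
          (rBlkWt ((ℓ + 1) ^ k) R (fineDom ((ℓ + 1) ^ k) R)) (fieldLink F (e / ((ℓ + 1) ^ k : ℕ)) (acBond R Ac))
          (contourTrans (fieldLink F (e / ((ℓ + 1) ^ k : ℕ)) (acBond R Ac)) (rbaseEmb hn R)
            (rstairContour hn R)) := fun R => rfl
  have hreg' : regionOp F e hn (B1.aSeq a ((ℓ : ℝ) + 1) k) m2 Ωc Ac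
      = regOp F (e / ((ℓ + 1) ^ k : ℕ)) hn Ωc m2 (B1.aSeq a ((ℓ : ℝ) + 1) k * (((((ℓ + 1) ^ k : ℕ)) : ℝ) ^ (d + 1))⁻¹)
          (compField Ac) := rfl
  rw [hreg', hreg Ω₀c]
  refine main.trans (le_of_eq ?_)
  rw [hc₀]


end Standard

end

end Literature.MathematicalPhysics.QuantumFieldTheory.Balaban1983to89.B4Thm112RegionLp
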